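import Mathlib
import Summits.ResolutionOfSingularities.ResolutionOfSingularities.Theorems.RadicialJungCleanModelsCleanPatchingDefs
import Summits.ResolutionOfSingularities.ResolutionOfSingularities.Theorems.RadicialJungCleanModelsCleanSpreadsRegularType
import Summits.ResolutionOfSingularities.ResolutionOfSingularities.Theorems.RadicialJungCleanModelsCleanSpreadsToroidal
import Literature.AlgebraicGeometry.Resolution.LocalBlowup
import Literature.AlgebraicGeometry.Resolution.StrictNormalCrossingsDescent
import HarnessLib

/-!
# Route `RadicialJung`, crux `CleanModels` (stmt-ResolutionOfSingularities-15917), line `Sketch` rev 14, stub 4a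
# `stub_cleanCharts3`: SPREADING a loose clean form from a closed centre, in the currency `locAtCentre`

Let `A ⊆ K` be (the subring of) a finitely generated subalgebra of a field `K` of characteristic `p` over a field `k`,
`O₀` a valuation subring of `K` containing `A` whose centre `𝔭 = 𝔪_{O₀} ∩ A` is a MAXIMAL ideal, with `R = A_𝔭`
(`locAtCentre A O₀`) regular, and let a representative `X = ∑ cⱼ^p g₀^j` of the `K^p`-line of `g₀` have a loose clean
form at `R` (`LooseCleanForm p R.subtype X`).  Then, after TWISTING the representative by a `p`-th power (to clear the
denominators of the data of the form), the landed algebra-level spreading lemmas `spreads_of_toroidal`,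
`spreads_of_unit`, `spreads_of_parameter` (support files of `stub_cleanSpreads`, which work at EVERY prime `𝔮 ≠ 𝔭` off a
hypersurface) give `h ∈ A ∖ 𝔭` such that the twisted representative has a loose clean form at every REGULAR localisation
`A_𝔮`, `h ∉ 𝔮`, `𝔮 ≠ 𝔭`, read in `K` (`exists_spread_of_looseCleanForm`).  All PROVED; bookkeeping for the clean charts of
Zariski patching for clean pairs; nothing here proves resolution in characteristic `p`.
-/

noncomputable section

set_option linter.dupNamespace false -- mandated namespace of this single-conjunct summit

open IsLocalRing
open Literature.AlgebraicGeometry.Resolution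

namespace Summit.ResolutionOfSingularities.ResolutionOfSingularities.Theorems.RadicialJung.CleanModels

variable {K : Type} [Field K] {p : ℕ}

/-! ## Twisting a representative of the `K^p`-line -/

/-- Twisting the coefficients of a representative `∑ cⱼ^p g₀^j` by `D` multiplies it by `D^p`. [folklore] -/
theorem sum_twist_eq (c : Fin p → K) (g₀ D : K) :
    (∑ j : Fin p, (c j * D) ^ p * g₀ ^ (j : ℕ)) = D ^ p * ∑ j : Fin p, c j ^ p * g₀ ^ (j : ℕ) := by
  rw [Finset.mul_sum]
  refine Finset.sum_congr rfl fun j _ => ?_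
  rw [mul_pow]; ring

/-- A twist by a nonzero `D` keeps a representative non-trivial. [folklore] -/
theorem nontriv_twist {c : Fin p → K} (hc : ∃ j : Fin p, (j : ℕ) ≠ 0 ∧ c j ≠ 0) {D : K} (hD : D ≠ 0) :
    ∃ j : Fin p, (j : ℕ) ≠ 0 ∧ c j * D ≠ 0 := by
  obtain ⟨j, hj, hcj⟩ := hc
  exact ⟨j, hj, mul_ne_zero hcj hD⟩

/-! ## Numerators in a localisation inside `K` -/

section Spread

variable {k : Type} [Field k] [Algebra k K] [Fact p.Prime] [CharP K p]
  (A : Subalgebra k K) (O₀ : ValuationSubring K) (hAO₀ : A.toSubring ≤ O₀.toSubring)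

/-- Notation-free abbreviation used in the statements below: the centre of `O₀` on `A`. [folklore] -/
theorem subringCentre_ne_top : subringCentre A.toSubring O₀ hAO₀ ≠ ⊤ :=
  Ideal.IsPrime.ne_top'

/-- An element of `A` off the centre of `O₀` is a unit of `O₀` (value `1`) and nonzero. [folklore] -/
theorem ne_zero_of_not_mem_subringCentre {s : A.toSubring} (hs : s ∉ subringCentre A.toSubring O₀ hAO₀) :
    (s : K) ≠ 0 :=
  ne_zero_of_valuation_eq_one (valuation_eq_one_of_not_mem_subringCentre hAO₀ hs)

/-- **Numerators**: every element of `A_𝔭 ⊆ K` is `a / s` with `a ∈ A`, `s ∈ A ∖ 𝔭`; inside `A_𝔭`,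
`z * s = a`. [folklore] -/
theorem exists_num_den (z : locAtCentre A.toSubring O₀) :
    ∃ (a s : A.toSubring), s ∉ subringCentre A.toSubring O₀ hAO₀ ∧
      (z : K) * (s : K) = (a : K) ∧ O₀.valuation (s : K) = 1 := by
  obtain ⟨y, hy, w, hw, hv, hz⟩ := z.2
  refine ⟨⟨y, hy⟩, ⟨w, hw⟩, ?_, ?_, hv⟩
  · rw [mem_subringCentre_iff]; exact fun hlt => lt_irrefl _ (hv ▸ hlt)
  · change (z : K) * w = y
    rw [hz, div_mul_cancel₀ _ (ne_zero_of_valuation_eq_one hv)]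

/-- An element of `A ∖ 𝔭` is a unit of `A_𝔭 = locAtCentre A O₀`. [folklore] -/
theorem isUnit_algebraMap_of_not_mem {s : A.toSubring} (hs : s ∉ subringCentre A.toSubring O₀ hAO₀) :
    IsUnit (algebraMap A.toSubring (locAtCentre A.toSubring O₀) s) :=
  haveI := isLocalization_locAtCentre hAO₀
  IsLocalization.map_units (M := (subringCentre A.toSubring O₀ hAO₀).primeCompl) _ ⟨s, hs⟩


/-- The numerator equation inside `A_𝔭`: `algebraMap a = z * algebraMap s`. [folklore] -/
theorem exists_num_den' (z : locAtCentre A.toSubring O₀) :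
    ∃ (a s : A.toSubring), s ∉ subringCentre A.toSubring O₀ hAO₀ ∧
      algebraMap A.toSubring (locAtCentre A.toSubring O₀) a = z * algebraMap A.toSubring _ s ∧
      (z : K) * (s : K) = (a : K) := by
  obtain ⟨a, s, hs, hmul, -⟩ := exists_num_den A O₀ hAO₀ z
  exact ⟨a, s, hs, Subtype.ext (by rw [Subring.coe_mul]; exact hmul.symm), hmul⟩

omit [Fact p.Prime] [CharP K p] in
/-- Spans of families differing by units agree. [folklore] -/
theorem span_range_eq_of_mul_isUnit {R : Type*} [CommRing R] {ι : Type*} (f g : ι → R)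
    (h : ∀ i, ∃ w : R, IsUnit w ∧ f i = g i * w) : Ideal.span (Set.range f) = Ideal.span (Set.range g) := by
  apply le_antisymm
  · rw [Ideal.span_le]
    rintro _ ⟨i, rfl⟩
    obtain ⟨w, -, hw⟩ := h i
    rw [hw]
    exact Ideal.mul_mem_right _ _ (Ideal.subset_span ⟨i, rfl⟩)
  · rw [Ideal.span_le]
    rintro _ ⟨i, rfl⟩
    obtain ⟨w, hw, hfw⟩ := h i
    obtain ⟨v, rfl⟩ := hw
    have : g i = f i * ↑v⁻¹ := by rw [hfw, mul_assoc, Units.mul_inv, mul_one]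
    rw [this]
    exact Ideal.mul_mem_right _ _ (Ideal.subset_span ⟨i, rfl⟩)

/-- **Numerators of a family**: replacing each member of a family in `A_𝔭` by a numerator in `A` does not change the
ideal it spans. [folklore] -/
theorem exists_numerators {ι : Type} [Finite ι] (t : ι → locAtCentre A.toSubring O₀) :
    ∃ (n d : ι → A.toSubring), (∀ i, d i ∉ subringCentre A.toSubring O₀ hAO₀) ∧
      (∀ i, algebraMap A.toSubring (locAtCentre A.toSubring O₀) (n i) = t i * algebraMap A.toSubring _ (d i)) ∧
      (∀ i, (t i : K) * (d i : K) = (n i : K)) ∧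
      Ideal.span (Set.range fun i => algebraMap A.toSubring (locAtCentre A.toSubring O₀) (n i)) =
        Ideal.span (Set.range t) := by
  choose n d hd hmul hK using fun i => exists_num_den' A O₀ hAO₀ (t i)
  refine ⟨n, d, hd, hmul, hK, span_range_eq_of_mul_isUnit _ _ fun i => ⟨_, isUnit_algebraMap_of_not_mem A O₀ hAO₀ (hd i), hmul i⟩⟩


/-! ## Spreading, case by case (after a twist clearing denominators) -/

/-- **Case (2): a unit whose residue is not a `p`-th power.**  `X = u`, `u = n/d`; the twisted representative
`d^p X = n d^{p-1} ∈ A ∖ 𝔭` still has a residue which is not a `p`-th power, and `spreads_of_unit` applies. [folklore] -/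
theorem spread_of_unitForm (hfg : A.FG) (hmax : (subringCentre A.toSubring O₀ hAO₀).IsMaximal)
    (hreg : IsRegularLocalRing (locAtCentre A.toSubring O₀))
    (g₀ : K) (c : Fin p → K) (hc : ∃ j : Fin p, (j : ℕ) ≠ 0 ∧ c j ≠ 0)
    (u : locAtCentre A.toSubring O₀) (hXeq : (∑ j : Fin p, c j ^ p * g₀ ^ (j : ℕ)) = (u : K))
    (hcu : ∀ c' : locAtCentre A.toSubring O₀, u - c' ^ p ∉ maximalIdeal (locAtCentre A.toSubring O₀)) :
    ∃ (h : A.toSubring) (c' : Fin p → K), h ∉ subringCentre A.toSubring O₀ hAO₀ ∧ (∃ j : Fin p, (j : ℕ) ≠ 0 ∧ c' j ≠ 0) ∧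
      ∀ (𝔮 : Ideal A.toSubring) [𝔮.IsPrime], h ∉ 𝔮 → 𝔮 ≠ subringCentre A.toSubring O₀ hAO₀ →
        ∀ (O' : Type) [CommRing O'] [Algebra A.toSubring O'] [IsLocalization.AtPrime O' 𝔮] [IsRegularLocalRing O']
          [Algebra O' K] [IsScalarTower A.toSubring O' K],
          LooseCleanForm p (algebraMap O' K) (∑ j : Fin p, c' j ^ p * g₀ ^ (j : ℕ)) := by
  classical
  have hp : p.Prime := Fact.out
  haveI := hmax
  haveI := hreg
  haveI := isLocalization_locAtCentre hAO₀
  letI : Algebra k A.toSubring := inferInstanceAs (Algebra k A)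
  haveI : Algebra.FiniteType k A.toSubring := (A.fg_iff_finiteType.mp hfg : Algebra.FiniteType k A)
  -- a regular system of parameters of `R = A_𝔭` with numerators in `A`
  obtain ⟨e, y, hdimR, hspan_y⟩ := exists_extend_to_rsop (R := locAtCentre A.toSubring O₀) (r := 0) Fin.elim0
    (fun i => i.elim0) (fun _ _ i => i.elim0)
  obtain ⟨ny, dy, hdy, hmuly, hKy, hspan_ny⟩ := exists_numerators A O₀ hAO₀ y
  have hspan' : Ideal.span (Set.range fun i => algebraMap A.toSubring (locAtCentre A.toSubring O₀) (ny i)) =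
      maximalIdeal (locAtCentre A.toSubring O₀) := by
    rw [hspan_ny, ← hspan_y]
    congr 1
    ext z
    simp [Set.range_eq_empty]
  have hdimR' : ringKrullDim (locAtCentre A.toSubring O₀) = (e : ℕ) := by simpa using hdimR
  -- numerator of `u`
  obtain ⟨nu, du, hdu, hmulu, hKu⟩ := exists_num_den' A O₀ hAO₀ u
  obtain ⟨q, hq⟩ : ∃ q : ℕ, p = q + 1 := ⟨p - 1, (Nat.sub_add_cancel hp.one_le).symm⟩
  -- the twisted representative `du^p · X = nu · du^(p-1)`
  have hX' : (∑ j : Fin p, (c j * (du : K)) ^ p * g₀ ^ (j : ℕ)) =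
      algebraMap A.toSubring K (nu * du ^ q) := by
    rw [sum_twist_eq, hXeq]
    have : algebraMap A.toSubring K (nu * du ^ q) = (nu : K) * (du : K) ^ q := by
      rw [map_mul, map_pow]; rfl
    rw [this, ← hKu, hq]
    ring
  have hu₀R : algebraMap A.toSubring (locAtCentre A.toSubring O₀) (nu * du ^ q) =
      u * algebraMap A.toSubring (locAtCentre A.toSubring O₀) du ^ p := by
    rw [map_mul, map_pow, hmulu, hq]
    ring
  have hup : ∀ c' : locAtCentre A.toSubring O₀,
      algebraMap A.toSubring (locAtCentre A.toSubring O₀) (nu * du ^ q) - c' ^ p ∉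
        maximalIdeal (locAtCentre A.toSubring O₀) := by
    intro c' hmem
    obtain ⟨w, hw⟩ := isUnit_algebraMap_of_not_mem A O₀ hAO₀ hdu
    apply hcu (c' * ↑w⁻¹)
    have hcancel : (↑w⁻¹ : locAtCentre A.toSubring O₀) ^ p * (u * ↑w ^ p) = u := by
      rw [mul_comm u, ← mul_assoc, ← mul_pow, Units.inv_mul, one_pow, one_mul]
    have hkey : u - (c' * ↑w⁻¹) ^ p =
        (↑w⁻¹) ^ p * (algebraMap A.toSubring (locAtCentre A.toSubring O₀) (nu * du ^ q) - c' ^ p) := by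
      rw [hu₀R, ← hw, mul_sub, hcancel, mul_pow, mul_comm ((↑w⁻¹ : locAtCentre A.toSubring O₀) ^ p)]
    rw [hkey]
    exact Ideal.mul_mem_left _ _ hmem
  obtain ⟨h, hh, H⟩ := spreads_of_unit k p hp (subringCentre A.toSubring O₀ hAO₀) (locAtCentre A.toSubring O₀)
    (∑ j : Fin p, (c j * (du : K)) ^ p * g₀ ^ (j : ℕ)) (fun i => ny i) (nu * du ^ q) hspan' hdimR' hX' hup
  refine ⟨h, fun j => c j * du, hh, nontriv_twist hc (ne_zero_of_not_mem_subringCentre A O₀ hAO₀ hdu),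
    fun 𝔮 _ hh𝔮 hne O' _ _ _ _ _ _ => ?_⟩
  exact H 𝔮 hh𝔮 hne O'

include hAO₀ in
/-- A unit of `A_𝔭 ⊆ O₀` has value `1`. [folklore] -/
theorem valuation_eq_one_of_isUnit_locAtCentre {u : locAtCentre A.toSubring O₀} (hu : IsUnit u) :
    O₀.valuation (u : K) = 1 := by
  have hle : O₀.valuation (u : K) ≤ 1 := (O₀.valuation_le_one_iff _).mpr (locAtCentre_le hAO₀ u.2)
  rcases hle.lt_or_eq with hlt | heq
  · exact absurd hlt ((not_isUnit_locAtCentre_iff hAO₀ u).not.mp (not_not.mpr hu))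
  · exact heq

/-- **Case (3): `s - c^p` a regular parameter.**  `X = s`, `s = nₛ/dₛ`, `c = n_c/d_c`; the twisted representative
`(dₛ d_c)^p X = nₛ dₛ^{p-1} d_c^p =: s'` satisfies `s' - (n_c dₛ)^p = (dₛ d_c)^p (s - c^p)`, again a regular parameter,
a member of a regular system of parameters with numerators in `A`; `spreads_of_parameter` applies. [folklore] -/
theorem spread_of_parameterForm (hfg : A.FG) (hmax : (subringCentre A.toSubring O₀ hAO₀).IsMaximal)
    (hreg : IsRegularLocalRing (locAtCentre A.toSubring O₀))
    (g₀ : K) (c : Fin p → K) (hc : ∃ j : Fin p, (j : ℕ) ≠ 0 ∧ c j ≠ 0)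
    (s₀ c₀ : locAtCentre A.toSubring O₀) (hXeq : (∑ j : Fin p, c j ^ p * g₀ ^ (j : ℕ)) = (s₀ : K))
    (h1 : s₀ - c₀ ^ p ∈ maximalIdeal (locAtCentre A.toSubring O₀))
    (h2 : s₀ - c₀ ^ p ∉ maximalIdeal (locAtCentre A.toSubring O₀) ^ 2) :
    ∃ (h : A.toSubring) (c' : Fin p → K), h ∉ subringCentre A.toSubring O₀ hAO₀ ∧ (∃ j : Fin p, (j : ℕ) ≠ 0 ∧ c' j ≠ 0) ∧
      ∀ (𝔮 : Ideal A.toSubring) [𝔮.IsPrime], h ∉ 𝔮 → 𝔮 ≠ subringCentre A.toSubring O₀ hAO₀ →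
        ∀ (O' : Type) [CommRing O'] [Algebra A.toSubring O'] [IsLocalization.AtPrime O' 𝔮] [IsRegularLocalRing O']
          [Algebra O' K] [IsScalarTower A.toSubring O' K],
          LooseCleanForm p (algebraMap O' K) (∑ j : Fin p, c' j ^ p * g₀ ^ (j : ℕ)) := by
  classical
  have hp : p.Prime := Fact.out
  haveI := hmax
  haveI := hreg
  haveI := isLocalization_locAtCentre hAO₀
  letI : Algebra k A.toSubring := inferInstanceAs (Algebra k A)
  haveI : Algebra.FiniteType k A.toSubring := (A.fg_iff_finiteType.mp hfg : Algebra.FiniteType k A)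
  obtain ⟨q, hq⟩ : ∃ q : ℕ, p = q + 1 := ⟨p - 1, (Nat.sub_add_cancel hp.one_le).symm⟩
  -- numerators of `s₀`, `c₀`
  obtain ⟨ns, ds, hds, hmuls, hKs⟩ := exists_num_den' A O₀ hAO₀ s₀
  obtain ⟨nc, dc, hdc, hmulc, hKc⟩ := exists_num_den' A O₀ hAO₀ c₀
  -- the twisted data in `A`: `s' = ns ds^(p-1) dc^p`, `c'' = nc ds`, `a₀ = s' - c''^p`
  have haM : ∀ x : A.toSubring, algebraMap A.toSubring K x = (x : K) := fun _ => rfl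
  obtain ⟨a₀, ha₀⟩ : ∃ a₀ : A.toSubring, a₀ = ns * ds ^ q * dc ^ p - (nc * ds) ^ p := ⟨_, rfl⟩
  have ha₀R : algebraMap A.toSubring (locAtCentre A.toSubring O₀) a₀ =
      (algebraMap A.toSubring (locAtCentre A.toSubring O₀) ds * algebraMap A.toSubring _ dc) ^ p * (s₀ - c₀ ^ p) := by
    rw [ha₀, map_sub, map_mul, map_mul, map_pow, map_pow, map_pow, map_mul, hmuls, hmulc, hq]
    ring
  have hWunit : IsUnit ((algebraMap A.toSubring (locAtCentre A.toSubring O₀) ds * algebraMap A.toSubring _ dc) ^ p) :=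
    ((isUnit_algebraMap_of_not_mem A O₀ hAO₀ hds).mul (isUnit_algebraMap_of_not_mem A O₀ hAO₀ hdc)).pow p
  have ha₀mem : algebraMap A.toSubring (locAtCentre A.toSubring O₀) a₀ ∈ maximalIdeal (locAtCentre A.toSubring O₀) := by
    rw [ha₀R]; exact Ideal.mul_mem_left _ _ h1
  have ha₀nmem : algebraMap A.toSubring (locAtCentre A.toSubring O₀) a₀ ∉
      maximalIdeal (locAtCentre A.toSubring O₀) ^ 2 := by
    rw [ha₀R]
    intro hmem
    obtain ⟨w, hw⟩ := hWunit
    apply h2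
    have : s₀ - c₀ ^ p = ↑w⁻¹ * ((algebraMap A.toSubring (locAtCentre A.toSubring O₀) ds *
        algebraMap A.toSubring _ dc) ^ p * (s₀ - c₀ ^ p)) := by
      rw [← hw, ← mul_assoc, Units.inv_mul, one_mul]
    rw [this]
    exact Ideal.mul_mem_left _ _ hmem
  -- extend `a₀` to a regular system of parameters of `R`
  obtain ⟨e, y, hdimR, hspan_y⟩ := exists_extend_to_rsop (R := locAtCentre A.toSubring O₀) (r := 1)
    (fun _ => algebraMap A.toSubring (locAtCentre A.toSubring O₀) a₀) (fun _ => ha₀mem) (by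
      intro cc hsum i
      rw [Fin.sum_univ_one] at hsum
      obtain rfl : i = 0 := Subsingleton.elim _ _
      by_contra hi
      rw [mem_maximalIdeal, mem_nonunits_iff, not_not] at hi
      obtain ⟨v, hv⟩ := hi
      apply ha₀nmem
      have : algebraMap A.toSubring (locAtCentre A.toSubring O₀) a₀ =
          ↑v⁻¹ * (cc 0 * algebraMap A.toSubring (locAtCentre A.toSubring O₀) a₀) := by
        rw [← hv, ← mul_assoc, Units.inv_mul, one_mul]
      rw [this]
      exact Ideal.mul_mem_left _ _ hsum)
  obtain ⟨ny, dy, hdy, hmuly, hKy, hspan_ny⟩ := exists_numerators A O₀ hAO₀ y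
  -- the regular system of parameters `a = (a₀, ny)` with entries in `A`
  obtain ⟨a, ha⟩ : ∃ a : Fin (e + 1) → A.toSubring, a = Fin.cons a₀ ny := ⟨_, rfl⟩
  have hrange : Set.range (fun i => algebraMap A.toSubring (locAtCentre A.toSubring O₀) (a i)) =
      insert (algebraMap A.toSubring (locAtCentre A.toSubring O₀) a₀)
        (Set.range fun i => algebraMap A.toSubring (locAtCentre A.toSubring O₀) (ny i)) := by
    rw [show (fun i => algebraMap A.toSubring (locAtCentre A.toSubring O₀) (a i)) =
        (algebraMap A.toSubring (locAtCentre A.toSubring O₀)) ∘ a from rfl, Set.range_comp, ha, Fin.range_cons,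
      Set.image_insert_eq, ← Set.range_comp]
    rfl
  have hspan'' : Ideal.span (Set.range fun i => algebraMap A.toSubring (locAtCentre A.toSubring O₀) (a i)) =
      maximalIdeal (locAtCentre A.toSubring O₀) := by
    rw [← hspan_y, hrange, Set.insert_eq, Ideal.span_union, Ideal.span_union, hspan_ny, Set.range_const]
  have hd' : ringKrullDim (locAtCentre A.toSubring O₀) = ((e + 1 : ℕ) : WithBot ℕ∞) := by
    rw [hdimR, Nat.add_comm]
  have ha0 : a ⟨0, Nat.succ_pos e⟩ = ns * ds ^ q * dc ^ p - (nc * ds) ^ p := by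
    rw [← ha₀, ha]; rfl
  -- the twisted representative
  have hX' : (∑ j : Fin p, (c j * ((ds : K) * dc)) ^ p * g₀ ^ (j : ℕ)) =
      algebraMap A.toSubring K (ns * ds ^ q * dc ^ p) := by
    rw [sum_twist_eq, hXeq, map_mul, map_mul, map_pow, map_pow, haM, haM, haM, ← hKs, hq]
    ring
  obtain ⟨h, hh, H⟩ := spreads_of_parameter k p hp (subringCentre A.toSubring O₀ hAO₀) (locAtCentre A.toSubring O₀)
    (∑ j : Fin p, (c j * ((ds : K) * dc)) ^ p * g₀ ^ (j : ℕ)) (Nat.succ_pos e) a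
    (ns * ds ^ q * dc ^ p) (nc * ds) hspan'' hd' ha0 hX'
  refine ⟨h, fun j => c j * ((ds : K) * dc), hh,
    nontriv_twist hc (mul_ne_zero (ne_zero_of_not_mem_subringCentre A O₀ hAO₀ hds)
      (ne_zero_of_not_mem_subringCentre A O₀ hAO₀ hdc)),
    fun 𝔮 _ hh𝔮 hne O' _ _ _ _ _ _ => ?_⟩
  exact H 𝔮 hh𝔮 hne O'

/-- **Case (1): the toroidal form.**  `X = u ∏ tᵢ^(aᵢ)`; with numerators `tᵢ = nᵢ/dᵢ`, `u = n_u/d_u`, the representative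
twisted by `D = d_u ∏ dᵢ^(aᵢ)` is `D^p X = (n_u d_u^{p-1} ∏ dᵢ^{aᵢ(p-1)}) · ∏ nᵢ^(aᵢ)`, toroidal with data in `A`;
`spreads_of_toroidal` applies. [folklore] -/
theorem spread_of_toroidalForm (hfg : A.FG) (hmax : (subringCentre A.toSubring O₀ hAO₀).IsMaximal)
    (hreg : IsRegularLocalRing (locAtCentre A.toSubring O₀))
    (g₀ : K) (c : Fin p → K) (hc : ∃ j : Fin p, (j : ℕ) ≠ 0 ∧ c j ≠ 0)
    {d m : ℕ} (hmd : m ≤ d) (t : Fin d → locAtCentre A.toSubring O₀) (a : Fin m → ℕ)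
    (u : locAtCentre A.toSubring O₀) (hu : IsUnit u)
    (hspan : Ideal.span (Set.range t) = maximalIdeal (locAtCentre A.toSubring O₀))
    (hdim : ringKrullDim (locAtCentre A.toSubring O₀) = (d : WithBot ℕ∞)) (hm : 0 < m) (ha : ∀ i, ¬ p ∣ a i)
    (hXeq : (∑ j : Fin p, c j ^ p * g₀ ^ (j : ℕ)) =
      (locAtCentre A.toSubring O₀).subtype (u * ∏ i : Fin m, t (Fin.castLE hmd i) ^ (a i))) :
    ∃ (h : A.toSubring) (c' : Fin p → K), h ∉ subringCentre A.toSubring O₀ hAO₀ ∧ (∃ j : Fin p, (j : ℕ) ≠ 0 ∧ c' j ≠ 0) ∧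
      ∀ (𝔮 : Ideal A.toSubring) [𝔮.IsPrime], h ∉ 𝔮 → 𝔮 ≠ subringCentre A.toSubring O₀ hAO₀ →
        ∀ (O' : Type) [CommRing O'] [Algebra A.toSubring O'] [IsLocalization.AtPrime O' 𝔮] [IsRegularLocalRing O']
          [Algebra O' K] [IsScalarTower A.toSubring O' K],
          LooseCleanForm p (algebraMap O' K) (∑ j : Fin p, c' j ^ p * g₀ ^ (j : ℕ)) := by
  classical
  have hp : p.Prime := Fact.out
  haveI := hmax
  haveI := hreg
  haveI := isLocalization_locAtCentre hAO₀
  letI : Algebra k A.toSubring := inferInstanceAs (Algebra k A)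
  haveI : Algebra.FiniteType k A.toSubring := (A.fg_iff_finiteType.mp hfg : Algebra.FiniteType k A)
  obtain ⟨q, hq⟩ : ∃ q : ℕ, p = q + 1 := ⟨p - 1, (Nat.sub_add_cancel hp.one_le).symm⟩
  have haM : ∀ x : A.toSubring, algebraMap A.toSubring K x = (x : K) := fun _ => rfl
  -- numerators
  obtain ⟨nt, dt, hdt, hmult, hKt, hspan_nt⟩ := exists_numerators A O₀ hAO₀ t
  obtain ⟨nu, du, hdu, hmulu, hKu⟩ := exists_num_den' A O₀ hAO₀ u
  -- the twist `D` and the twisted unit `u₀`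
  obtain ⟨D, hD⟩ : ∃ D : K, D = (du : K) * ∏ i : Fin m, (dt (Fin.castLE hmd i) : K) ^ (a i) := ⟨_, rfl⟩
  have hD0 : D ≠ 0 := by
    rw [hD]
    refine mul_ne_zero (ne_zero_of_not_mem_subringCentre A O₀ hAO₀ hdu) (Finset.prod_ne_zero_iff.mpr fun i _ => ?_)
    exact pow_ne_zero _ (ne_zero_of_not_mem_subringCentre A O₀ hAO₀ (hdt _))
  obtain ⟨u₀, hu₀⟩ : ∃ u₀ : A.toSubring, u₀ = nu * du ^ q * ∏ i : Fin m, dt (Fin.castLE hmd i) ^ (a i * q) :=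
    ⟨_, rfl⟩
  have hu₀K : (u₀ : K) = (nu : K) * (du : K) ^ q * ∏ i : Fin m, (dt (Fin.castLE hmd i) : K) ^ (a i * q) := by
    rw [hu₀, ← haM, map_mul, map_mul, map_pow, map_prod]
    simp only [haM, Subring.coe_pow]
  have hvu : O₀.valuation (u : K) = 1 := valuation_eq_one_of_isUnit_locAtCentre A O₀ hAO₀ hu
  have hvnu : O₀.valuation (nu : K) = 1 := by
    rw [← hKu, map_mul, hvu, valuation_eq_one_of_not_mem_subringCentre hAO₀ hdu, one_mul]
  have hu₀𝔭 : u₀ ∉ subringCentre A.toSubring O₀ hAO₀ := by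
    rw [mem_subringCentre_iff, hu₀K, map_mul, map_mul, map_pow, map_prod, hvnu,
      valuation_eq_one_of_not_mem_subringCentre hAO₀ hdu, one_pow, one_mul, one_mul]
    rw [Finset.prod_eq_one fun i _ => by rw [map_pow, valuation_eq_one_of_not_mem_subringCentre hAO₀ (hdt _), one_pow]]
    exact lt_irrefl 1
  have hspan' : Ideal.span (Set.range fun i => algebraMap A.toSubring (locAtCentre A.toSubring O₀) (nt i)) =
      maximalIdeal (locAtCentre A.toSubring O₀) := hspan_nt.trans hspan
  -- the twisted representative
  have hX' : (∑ j : Fin p, (c j * D) ^ p * g₀ ^ (j : ℕ)) =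
      algebraMap A.toSubring K (u₀ * ∏ i : Fin m, nt (Fin.castLE hmd i) ^ (a i)) := by
    rw [sum_twist_eq, hXeq, map_mul, map_prod, map_mul, map_prod, haM, hu₀K]
    simp only [map_pow, haM, Subring.coe_subtype, Subring.coe_pow]
    simp only [← hKt, ← hKu]
    rw [hD, hq]
    simp only [mul_pow, Finset.prod_mul_distrib, pow_mul, Finset.prod_pow]
    ring
  obtain ⟨h, hh, H⟩ := spreads_of_toroidal k p hp (subringCentre A.toSubring O₀ hAO₀) (locAtCentre A.toSubring O₀)
    (∑ j : Fin p, (c j * D) ^ p * g₀ ^ (j : ℕ)) hmd nt a u₀ hu₀𝔭 hspan' hdim hm ha hX'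
  refine ⟨h, fun j => c j * D, hh, nontriv_twist hc hD0, fun 𝔮 _ hh𝔮 hne O' _ _ _ _ _ _ => ?_⟩
  exact H 𝔮 hh𝔮 hne O'

/-- **Spreading a loose clean form from a closed centre** (the three cases together): if a representative
`X = ∑ cⱼ^p g₀^j` of the `K^p`-line of `g₀` has a loose clean form at `A_𝔭` (`𝔭 = 𝔪_{O₀} ∩ A` maximal, `A_𝔭` regular),
then for some `h ∈ A ∖ 𝔭` and some (twisted) non-trivial representative `X' = ∑ c'ⱼ^p g₀^j`, `X'` has a loose clean form at
every regular localisation `A_𝔮` with `h ∉ 𝔮`, `𝔮 ≠ 𝔭`, read in `K`. [folklore] -/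
theorem exists_spread_of_looseCleanForm (hfg : A.FG) (hmax : (subringCentre A.toSubring O₀ hAO₀).IsMaximal)
    (hreg : IsRegularLocalRing (locAtCentre A.toSubring O₀))
    (g₀ : K) (c : Fin p → K) (hc : ∃ j : Fin p, (j : ℕ) ≠ 0 ∧ c j ≠ 0)
    (hX : LooseCleanForm p (locAtCentre A.toSubring O₀).subtype (∑ j : Fin p, c j ^ p * g₀ ^ (j : ℕ))) :
    ∃ (h : A.toSubring) (c' : Fin p → K), h ∉ subringCentre A.toSubring O₀ hAO₀ ∧ (∃ j : Fin p, (j : ℕ) ≠ 0 ∧ c' j ≠ 0) ∧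
      ∀ (𝔮 : Ideal A.toSubring) [𝔮.IsPrime], h ∉ 𝔮 → 𝔮 ≠ subringCentre A.toSubring O₀ hAO₀ →
        ∀ (O' : Type) [CommRing O'] [Algebra A.toSubring O'] [IsLocalization.AtPrime O' 𝔮] [IsRegularLocalRing O']
          [Algebra O' K] [IsScalarTower A.toSubring O' K],
          LooseCleanForm p (algebraMap O' K) (∑ j : Fin p, c' j ^ p * g₀ ^ (j : ℕ)) := by
  haveI := hreg
  rcases hX with ⟨d, m, hmd, t, a, u, hu, hspan, hdim, hm, ha, hXeq⟩ | ⟨u, hu, hXeq, hcu⟩ | ⟨s₀, c₀, hXeq, h1, h2⟩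
  · exact spread_of_toroidalForm A O₀ hAO₀ hfg hmax hreg g₀ c hc hmd t a u hu hspan hdim hm ha hXeq
  · exact spread_of_unitForm A O₀ hAO₀ hfg hmax hreg g₀ c hc u hXeq hcu
  · exact spread_of_parameterForm A O₀ hAO₀ hfg hmax hreg g₀ c hc s₀ c₀ hXeq h1 h2

end Spread

end Summit.ResolutionOfSingularities.ResolutionOfSingularities.Theorems.RadicialJung.CleanModels

end
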